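import Mathlib
import Summits.MatrixMultiplication.MatrixMultiplication.Theorems.SnSubsetDichotomyNoThresholdSubsetTriplePlancherelStepDefs
import Summits.MatrixMultiplication.MatrixMultiplication.Theorems.SnSubsetDichotomyNoThresholdSubsetTripleTransProbSum

/-!
# `SnSubsetDichotomy.NoThresholdSubsetTriple`, line `klr-graded-polynomial-method`:
# stub `sqEnergy_le_sq_of_abs_incr_le` (bounded increments give bounded conditional second moment)

For a finite lower set `ν ⊆ ℕ × ℕ` (a Young diagram), the conditional second moment of the
J-increment under one Plancherel step, `q(ν) = Σ_{y addable} p_y · x_y²` (`PlancherelStep.sqEnergy`),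
is at most `B²` as soon as `|x_y| ≤ B` at every addable node `y`: the transition probabilities `p_y`
are nonnegative (`PlancherelStep.transProb_nonneg`) and sum to one (`transProb_sum_eq_one`,
Greene–Nijenhuis–Wilf), so `q(ν) ≤ Σ_y p_y · B² = B²`.
-/

open scoped BigOperators
open Literature.RepresentationTheory.FiniteGroups (addableNodes IsAddableNode)

namespace Summit.MatrixMultiplication.MatrixMultiplication.Theorems

open PlancherelStep

set_option linter.dupNamespace false in -- deliberate Summit.<S>.<P> duplicate
/-- **Bounded increments give a bounded conditional second moment.** If `ν` is a Young diagram
(finite lower set of `ℕ × ℕ`) and the J-increment satisfies `|x_y| ≤ B` at every addable node `y`,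
then `q(ν) = Σ_{y addable} p_y · x_y² ≤ B²`, because the Plancherel transition probabilities `p_y`
are nonnegative and sum to one. [folklore] -/
theorem sqEnergy_le_sq_of_abs_incr_le : ∀ (ν : Finset (ℕ × ℕ)), IsLowerSet (ν : Set (ℕ × ℕ)) →
    ∀ (B : ℕ), (∀ y ∈ addableNodes ν, |incr ν y| ≤ (B : ℤ)) → sqEnergy ν ≤ ((B : ℝ)) ^ 2 := by
  intro ν hν B hB
  unfold sqEnergy
  calc ∑ y ∈ addableNodes ν, transProb ν y * ((incr ν y : ℝ) ^ 2)
      ≤ ∑ y ∈ addableNodes ν, transProb ν y * ((B : ℝ) ^ 2) := by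
        refine Finset.sum_le_sum fun y hy => mul_le_mul_of_nonneg_left ?_ (transProb_nonneg ν y)
        have h : |(incr ν y : ℝ)| ≤ (B : ℝ) := by exact_mod_cast hB y hy
        rw [← sq_abs]
        exact pow_le_pow_left₀ (abs_nonneg _) h 2
    _ = (B : ℝ) ^ 2 := by rw [← Finset.sum_mul, transProb_sum_eq_one ν hν, one_mul]

end Summit.MatrixMultiplication.MatrixMultiplication.Theorems
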